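/-
Copyright (c) 2026 the pub-hodgecm-mathlib formalisation cell (harness21).  Prover seat hodgecm-mathlib-LH7-p07 (g0), Track A «(D-RAM) FOUR-FRAME» squad, helper lane on
h413 = stmt-HodgeConjecture-24833 (count-neutral).  β-BOARD v1 (sub-dealer LH4-p05 (g8)) RULING 15:31:23Z, consumer letter LH7-p05 (g0) 15:33:01Z: the ONE-LEMMA window sum.  2026-09-04.
-/
import Summits.HodgeConjecture.HodgeConjecture.Theorems.F0P3cDyRamGlueShellLinearisation   -- (this seat) L4a: `sum_sum_glueShell_eq_sum_image`, `glueShell_image_sub∕_complete∕_irredundant`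
import Summits.HodgeConjecture.HodgeConjecture.Theorems.F0P3cDyRamGlueResidueSystems       -- (this seat) `norm_witness_iff_v_sub_le` (the norm-depth bridge), `one_add_letters`
import HarnessLib

/-!
# Crux `H413`, line LH4 «(D-RAM) FOUR-FRAME» — β-BOARD R7 «GLUE CLASSES», THEOREM C: THE WINDOW SUM IN ONE LEMMA —
# `Σ_{g ∈ R.filter cut} Σ_{aβ ∈ Aβ} F(g + (1+g)(aβ − 1)) = Σ_{r ∈ Sh} F r` for every class function `F` and EVERY complete irredundant system `Sh` of the F-shell

Cell `hodgecm-mathlib` (D-0151), FLOOR 0, crux item H413 = `stmt-HodgeConjecture-24833`, route `HCCMUnconditional`; squad F0∕P3c∕LH4, β-BOARD v1 row R7 (holder LH7-p05 (g0); the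
statement is LH7-p05's consumer sentence of 2026-09-04T15:33:01Z VERBATIM in shape: ★ (iv-c) letters `R hR1 hR2 hR3`, ★ PT-3 letters `Aβ hAβsub hAβ`, cut `|g + c₀| = |ϖ|^e`, any system
`Sh` of the shell `{σr = r, |r| = |ϖ|^s, |r + c₀| = |ϖ|^e}` modulo `𝔭^{2M}`, `F` constant on the `𝔭^{2M}`-classes of the shell).  THEOREMS ONLY (no `def`, no instance, no notation, no
`sorry`, default heartbeats); ★-only imports; lane `--supports stmt-HodgeConjecture-24833 --as helper`; pays NO row, states NO law.

THE PROOF.  (1) The NORM-DEPTH BRIDGE (`F0P3cDyRamGlueResidueSystems.norm_witness_iff_v_sub_le`) read BACKWARDS: ★ PT-3's multiplicative ∃!-system `Aβ` of `U_F^{[n]} ∕ N(U_E^{[k]})`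
gives the ADDITIVE complete irredundant system `Aβ.image (· − 1)` of the fixed ball `|b| ≤ |ϖ|^n` modulo `𝔭^{2M}` (`2M ≤ k + d ≤ 2M + 1`, `d ≤ M ≤ k`) — §1 `image_sub_one_repr`.
(2) L4a (`F0P3cDyRamGlueShellLinearisation.sum_sum_glueShell_eq_sum_image`): the double sum is the sum over the image system of the shell.  (3) §2 `sum_repr_eq_sum_repr` (datum-free):
two complete irredundant systems of one set carry the same sum of a class function.  HEAD §3 **`sum_filter_sum_eq_sum_shell`**; the on-foot `κ`-class (E = 0) is the same lemma at
`e = s` (the cut exponent is free), and the three slots are the class functions `ω(r + c₀)`, `ω(r(r + c₀))`, `ω((1 + r)(r + c₀))` (★ p861409 ∕ ★ p861281 (ii)).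
HONEST LABEL.  Count-neutral bookkeeping; R7 Theorem C, the (β) table, (β-BAL), T₊ stay OPEN; `HC_CM` is proved only modulo the 7 printed citations (2 remaining named inputs: hLiu418 =
`stmt-HodgeConjecture-24832`, h413 = `stmt-HodgeConjecture-24833`) until rung 0 closes.

## References
* [Serre1979] J.-P. Serre, *Local Fields*, GTM 67 (1979): Ch. II §1 (residue systems), Ch. V §3 Prop. 5, Cor. 2–3 pp. 85–87 (the unit filtration under the norm).
* [Kottwitz1986BaseChangeUnits] R. E. Kottwitz, *Base change for unit elements of Hecke algebras*, Compositio Math. 60 (1986): §1 pp. 240–241 (the glued lattice classes).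
-/

set_option autoImplicit false

noncomputable section

namespace Summit.HodgeConjecture.HodgeConjecture.Cruxes.H413.F0P3cDyRamGlueWindowSum

open WithZero
open scoped Valued
open Literature.NumberTheory.Automorphic.UnitaryThreeFourFrame
open Literature.NumberTheory.LocalFields.WildQuadraticDatum
open Summit.HodgeConjecture.HodgeConjecture.Cruxes.H413.F0P3cDyRamGlueShellLinearisation
open Summit.HodgeConjecture.HodgeConjecture.Cruxes.H413.F0P3cDyRamGlueResidueSystems

variable {K : Type} [Field K] [Valued K ℤᵐ⁰] {σ : K →+* K} {ϖ : K} {d t : ℕ}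

/-! ## §1  PT-3's `Aβ` gives an additive system of the ball (the bridge backwards) -/

variable [DecidableEq K]

/-- **`Aβ.image (· − 1)` IS A COMPLETE IRREDUNDANT SYSTEM OF THE FIXED BALL `|b| ≤ |ϖ|^n` MODULO `𝔭^{2M}`** whenever `Aβ` is ★ PT-3's ∃!-system of `U_F^{[n]}` modulo the norm
relation «`a∕y = sσs`, `|s − 1| ≤ |ϖ|^k`» and `2M ≤ k + d ≤ 2M + 1`, `d ≤ M ≤ k`, `1 ≤ n` (the bridge `norm_witness_iff_v_sub_le` turns the ∃! into additive completeness and irredundancy).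
[cite: Serre1979, Ch. V §3 Prop. 5, Cor. 2–3 pp. 85–87] -/
theorem image_sub_one_repr [CompleteSpace K] (hD : IsRamifiedQuadraticDatum σ ϖ d t) {n k M : ℕ} (hn : 1 ≤ n) (hMk : 2 * M ≤ k + d) (hkM : k + d ≤ 2 * M + 1)
    (hdM : d ≤ M) (hMk2 : M ≤ k) (Aβ : Finset K) (hAβsub : ∀ a ∈ Aβ, σ a = a ∧ Valued.v (a - 1) ≤ Valued.v ϖ ^ n)
    (hAβ : ∀ y : K, σ y = y → Valued.v (y - 1) ≤ Valued.v ϖ ^ n → ∃! a, a ∈ Aβ ∧ ∃ s : K, Valued.v (s - 1) ≤ Valued.v ϖ ^ k ∧ s * σ s = a / y) :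
    (∀ b ∈ Aβ.image (fun a => a - 1), σ b = b ∧ Valued.v b ≤ Valued.v ϖ ^ n) ∧
    (∀ b : K, σ b = b → Valued.v b ≤ Valued.v ϖ ^ n → ∃ b' ∈ Aβ.image (fun a => a - 1), Valued.v (b - b') ≤ Valued.v ϖ ^ (2 * M)) ∧
    (∀ b ∈ Aβ.image (fun a => a - 1), ∀ b' ∈ Aβ.image (fun a => a - 1), Valued.v (b - b') ≤ Valued.v ϖ ^ (2 * M) → b = b') := by
  -- every member of `Aβ` is a fixed unit
  have hunit : ∀ a ∈ Aβ, σ a = a ∧ Valued.v a = 1 := fun a ha => by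
    obtain ⟨hσa, hva⟩ := hAβsub a ha
    obtain ⟨-, h1, -⟩ := one_add_letters hD hn (b := a - 1) (by rw [map_sub, map_one, hσa]) hva
    rw [add_sub_cancel] at h1
    exact ⟨hσa, h1⟩
  refine ⟨?_, ?_, ?_⟩
  · intro b hb
    obtain ⟨a, ha, rfl⟩ := Finset.mem_image.1 hb
    obtain ⟨hσa, hva⟩ := hAβsub a ha
    exact ⟨by rw [map_sub, map_one, hσa], hva⟩
  · intro b hσb hvb
    obtain ⟨hσy, hvy, hy1⟩ := one_add_letters hD hn hσb hvb
    obtain ⟨a, ⟨ha, hs⟩, -⟩ := hAβ (1 + b) hσy hy1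
    refine ⟨a - 1, Finset.mem_image.2 ⟨a, ha, rfl⟩, ?_⟩
    have h := (norm_witness_iff_v_sub_le hD hMk hkM hdM hMk2 (hunit a ha).1 hσy hvy).1 hs
    rw [show b - (a - 1) = -(a - (1 + b)) by ring, Valuation.map_neg]
    exact h
  · intro b hb b' hb' hbb'
    obtain ⟨a, ha, rfl⟩ := Finset.mem_image.1 hb
    obtain ⟨a', ha', rfl⟩ := Finset.mem_image.1 hb'
    obtain ⟨hσa', hva'⟩ := hunit a' ha'
    have ha'0 : a' ≠ 0 := fun h0 => by rw [h0, map_zero] at hva'; exact zero_ne_one hva'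
    -- both `a` and `a′` represent `y := a′`
    have hex : ∃! x, x ∈ Aβ ∧ ∃ s : K, Valued.v (s - 1) ≤ Valued.v ϖ ^ k ∧ s * σ s = x / a' := hAβ a' hσa' (hAβsub a' ha').2
    have h1 : ∃ s : K, Valued.v (s - 1) ≤ Valued.v ϖ ^ k ∧ s * σ s = a / a' :=
      (norm_witness_iff_v_sub_le hD hMk hkM hdM hMk2 (hunit a ha).1 hσa' hva').2 (by rw [show a - a' = (a - 1) - (a' - 1) by ring]; exact hbb')
    have h2 : ∃ s : K, Valued.v (s - 1) ≤ Valued.v ϖ ^ k ∧ s * σ s = a' / a' :=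
      ⟨1, by rw [sub_self, map_zero]; exact zero_le, by rw [map_one, one_mul, div_self ha'0]⟩
    rw [hex.unique ⟨ha, h1⟩ ⟨ha', h2⟩]

/-! ## §2  Two complete irredundant systems of one set carry the same sum of a class function (datum-free) -/

omit [DecidableEq K] in
/-- **TRANSPORT BETWEEN TWO SYSTEMS**: `S`, `S′` complete irredundant systems of `A` modulo `𝔭^N`, `F` constant on the `𝔭^N`-classes of `A` ⟹ `Σ_{S} F = Σ_{S′} F` (the bijection
`s ↦ rep_{S′}(s)`). [cite: Serre1979, Ch. II §1] -/
theorem sum_repr_eq_sum_repr {M : Type} [AddCommMonoid M] {A : Set K} {N : ℕ} (S S' : Finset K)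
    (hS1 : ∀ s ∈ S, s ∈ A) (hS2 : ∀ a ∈ A, ∃ s ∈ S, Valued.v (a - s) ≤ Valued.v ϖ ^ N) (hS3 : ∀ s ∈ S, ∀ s' ∈ S, Valued.v (s - s') ≤ Valued.v ϖ ^ N → s = s')
    (hS'1 : ∀ s ∈ S', s ∈ A) (hS'2 : ∀ a ∈ A, ∃ s ∈ S', Valued.v (a - s) ≤ Valued.v ϖ ^ N) (hS'3 : ∀ s ∈ S', ∀ s' ∈ S', Valued.v (s - s') ≤ Valued.v ϖ ^ N → s = s')
    (F : K → M) (hF : ∀ a ∈ A, ∀ a' ∈ A, Valued.v (a - a') ≤ Valued.v ϖ ^ N → F a = F a') :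
    ∑ s ∈ S, F s = ∑ s ∈ S', F s := by
  classical
  have hrep : ∀ s ∈ S, ∃ s' ∈ S', Valued.v (s - s') ≤ Valued.v ϖ ^ N := fun s hs => hS'2 s (hS1 s hs)
  choose! ψ hψS hψ using hrep
  refine Finset.sum_bij (fun s _ => ψ s) (fun s hs => hψS s hs) ?_ ?_ (fun s hs => hF s (hS1 s hs) (ψ s) (hS'1 _ (hψS s hs)) (hψ s hs))
  · intro s₁ hs₁ s₂ hs₂ heq
    apply hS3 s₁ hs₁ s₂ hs₂
    have h1 := hψ s₁ hs₁
    have h2 := hψ s₂ hs₂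
    rw [heq] at h1
    rw [show s₁ - s₂ = (s₁ - ψ s₂) - (s₂ - ψ s₂) by ring]
    exact (Valuation.map_sub _ _ _).trans (max_le h1 h2)
  · intro s' hs'
    obtain ⟨s, hs, hss⟩ := hS2 s' (hS'1 s' hs')
    refine ⟨s, hs, hS'3 _ (hψS s hs) s' hs' ?_⟩
    rw [show ψ s - s' = (s - s') - (s - ψ s) by ring]
    refine (Valuation.map_sub _ _ _).trans (max_le ?_ (hψ s hs))
    rw [Valuation.map_sub_swap]; exact hss

/-! ## §3  HEAD — the window sum in one lemma -/

/-- **THE GLUE-WINDOW DOUBLE SUM IS THE SHELL SUM** (LH7-p05 (g0)'s consumer sentence).  Data: a ramified datum on a complete `K`; exponents `1 ≤ s < n`, `e < n`, `n ≤ 2M`,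
`2M ≤ k + d ≤ 2M + 1`, `d ≤ M ≤ k`; `R` = ★ (iv-c)'s complete irredundant system of `{σg = g, |g| = |ϖ|^s}` modulo `𝔭^n`; `Aβ` = ★ PT-3's ∃!-system of `U_F^{[n]}` modulo
«`a∕y = sσs`, `|s−1| ≤ |ϖ|^k`»; the cut `|g + c₀| = |ϖ|^e`; `Sh` ANY complete irredundant system modulo `𝔭^{2M}` of the shell `{σr = r, |r| = |ϖ|^s, |r + c₀| = |ϖ|^e}`; `F` constant on
the `𝔭^{2M}`-classes of the shell.  THEN `Σ_{g ∈ R.filter cut} Σ_{aβ ∈ Aβ} F(g + (1+g)(aβ − 1)) = Σ_{r ∈ Sh} F r`.  Letters of record: `s = 2t′`, `n = ρ + 2t′`, `k = 2ρ + 2t′`,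
`M = ρ + t′ + d∕2`, `e = 2t′ + E` (`E = 2ρ + ℓ₀ − m ≥ 0`; `E = 0` is the on-foot `κ`-class). [cite: Serre1979, Ch. V §3 Prop. 5, Cor. 2–3 pp. 85–87] [cite: Kottwitz1986BaseChangeUnits, §1 pp. 240–241] -/
theorem sum_filter_sum_eq_sum_shell {A : Type} [AddCommMonoid A] [CompleteSpace K] (hD : IsRamifiedQuadraticDatum σ ϖ d t)
    {s n k M e : ℕ} (hs : 1 ≤ s) (hsn : s < n) (hen : e < n) (hnM : n ≤ 2 * M) (hMk : 2 * M ≤ k + d) (hkM : k + d ≤ 2 * M + 1) (hdM : d ≤ M) (hMk2 : M ≤ k)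
    {c₀ : K} (R : Finset K) (hR1 : ∀ g ∈ R, σ g = g ∧ Valued.v g = Valued.v ϖ ^ s)
    (hR2 : ∀ f : K, σ f = f → Valued.v f = Valued.v ϖ ^ s → ∃ g ∈ R, Valued.v (f - g) ≤ Valued.v ϖ ^ n)
    (hR3 : ∀ g ∈ R, ∀ g' ∈ R, Valued.v (g - g') ≤ Valued.v ϖ ^ n → g = g')
    (Aβ : Finset K) (hAβsub : ∀ a ∈ Aβ, σ a = a ∧ Valued.v (a - 1) ≤ Valued.v ϖ ^ n)
    (hAβ : ∀ y : K, σ y = y → Valued.v (y - 1) ≤ Valued.v ϖ ^ n → ∃! a, a ∈ Aβ ∧ ∃ s : K, Valued.v (s - 1) ≤ Valued.v ϖ ^ k ∧ s * σ s = a / y)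
    (Sh : Finset K) (hSh1 : ∀ r ∈ Sh, σ r = r ∧ Valued.v r = Valued.v ϖ ^ s ∧ Valued.v (r + c₀) = Valued.v ϖ ^ e)
    (hSh2 : ∀ r : K, σ r = r → Valued.v r = Valued.v ϖ ^ s → Valued.v (r + c₀) = Valued.v ϖ ^ e → ∃ x ∈ Sh, Valued.v (r - x) ≤ Valued.v ϖ ^ (2 * M))
    (hSh3 : ∀ x ∈ Sh, ∀ x' ∈ Sh, Valued.v (x - x') ≤ Valued.v ϖ ^ (2 * M) → x = x')
    (F : K → A) (hF : ∀ r r' : K, σ r = r → Valued.v r = Valued.v ϖ ^ s → Valued.v (r + c₀) = Valued.v ϖ ^ e →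
      σ r' = r' → Valued.v r' = Valued.v ϖ ^ s → Valued.v (r' + c₀) = Valued.v ϖ ^ e → Valued.v (r - r') ≤ Valued.v ϖ ^ (2 * M) → F r = F r') :
    ∑ g ∈ R.filter (fun g => Valued.v (g + c₀) = Valued.v ϖ ^ e), ∑ a ∈ Aβ, F (g + (1 + g) * (a - 1)) = ∑ r ∈ Sh, F r := by
  obtain ⟨-, -, hϖ, -, -, -, -⟩ := id hD
  -- (1) the additive system `B := Aβ.image (· − 1)`
  obtain ⟨hB1, hB2, hB3⟩ := image_sub_one_repr hD (by omega) hMk hkM hdM hMk2 Aβ hAβsub hAβ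
  -- (2) re-index the inner sum over `B`
  have hinj : Set.InjOn (fun a : K => a - 1) ↑Aβ := fun a _ a' _ h => sub_left_injective h
  have hinner : ∀ g : K, ∑ a ∈ Aβ, F (g + (1 + g) * (a - 1)) = ∑ b ∈ Aβ.image (fun a => a - 1), F (g + (1 + g) * b) := fun g => by
    rw [Finset.sum_image hinj]
  rw [Finset.sum_congr rfl fun g _ => hinner g,
    sum_sum_glueShell_eq_sum_image (σ := σ) hϖ hs hsn hnM R hR1 hR3 _ hB1 hB3 F]
  -- (3) transport from the image system to `Sh`
  refine sum_repr_eq_sum_repr (A := {r : K | σ r = r ∧ Valued.v r = Valued.v ϖ ^ s ∧ Valued.v (r + c₀) = Valued.v ϖ ^ e}) _ Sh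
    (glueShell_image_sub hϖ hs hsn hen R hR1 _ hB1) ?_ (glueShell_image_irredundant hϖ hs hsn hnM R hR1 hR3 _ hB1 hB3)
    hSh1 (fun r hr => hSh2 r hr.1 hr.2.1 hr.2.2) hSh3 F (fun r hr r' hr' h => hF r r' hr.1 hr.2.1 hr.2.2 hr'.1 hr'.2.1 hr'.2.2 h)
  intro r hr
  exact glueShell_image_complete hϖ hs hen R hR1 hR2 _ hB2 r hr.1 hr.2.1 hr.2.2

end Summit.HodgeConjecture.HodgeConjecture.Cruxes.H413.F0P3cDyRamGlueWindowSum

end
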